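import Summits.KontsevichZagierPeriods.KontsevichZagierPeriods.Theorems.RootDecompOrderCutAdicStagesP4

/-! # `RootDecompOrderCutAdicStagesP5` — part 5/5 of the mechanical ≤350-line split of `src.lean`
(split by the decomp-kz census seat for landing; mathematics unchanged; part 5 continues part 4). -/

noncomputable section
open Literature.NumberTheory.Transcendental Literature.NumberTheory.Transcendental.KZ
open Summit.KontsevichZagierPeriods.KontsevichZagierPeriods.Theses
open Summit.KontsevichZagierPeriods.RootDecompPureDefect
open Summit.KontsevichZagierPeriods.RootDecompOrderCut
open Polynomial

namespace Summit.KontsevichZagierPeriods.RootDecompAdicStages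

namespace Iface

/-- `𝔓 ⊭ KrullSeparated`: `x = (x^{1/n})ⁿ ∈ 𝔪ⁿ` for every `n`. -/
theorem modelPuis_not_krull : ¬ KrullSeparatedI vPuis := by
  intro h
  refine xPuis_ne_zero (h xPuis fun n => ?_)
  rcases Nat.eq_zero_or_pos n with hn | hn
  · rw [hn, pow_zero, Ideal.one_eq_top]; exact Submodule.mem_top
  · have hn' : (n : NNRat) ≠ 0 := Nat.cast_ne_zero.mpr (Nat.pos_iff_ne_zero.mp hn)
    have e : xPuis = AddMonoidAlgebra.single ((1 : NNRat) / n) (1 : ℚ) ^ n := by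
      rw [AddMonoidAlgebra.single_pow, one_pow, nsmul_eq_mul, mul_one_div_cancel hn']
      rfl
    rw [e]
    exact Ideal.pow_mem_pow ((RingHom.mem_ker).mpr (vPuis_single_of_ne (div_ne_zero one_ne_zero hn') 1)) n

/-- Auxiliary step `modelPuis_not_s`. [bookkeeping] -/
theorem modelPuis_not_s : ¬ SI vPuis := fun h => xPuis_ne_zero (h xPuis vPuis_xPuis)

/-! ### Profiles and independence -/

/-- **THE TWO HALVES OF THE ADIC CUT ARE INDEPENDENT AND EACH IS WEAKER THAN `S`** (as consequences of the ring
axioms and a real character): `ℝ × ℝ ⊨ AdicDefect ∧ ¬AdicSeparated ∧ ¬S`, `ℝ[X] ⊨ AdicSeparated ∧ ¬AdicDefect ∧ ¬S`. -/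
theorem adic_halves_independent :
    (AdicDefectI vPair ∧ ¬ AdicSeparatedI vPair ∧ ¬ SI vPair) ∧
    (AdicSeparatedI vPoly ∧ ¬ AdicDefectI vPoly ∧ ¬ SI vPoly) :=
  ⟨⟨modelPair_adicDefect, modelPair_not_adicSeparated, modelPair_not_s⟩,
    ⟨modelPoly_adicSeparated, modelPoly_not_adicDefect, modelPoly_not_s⟩⟩

/-- **THE EXCHANGE IS FORCED** (vs g12's exact pair `KernelIdempotent ∧ KrullSeparated ⟺ S`): weakening the
right half `Krull ⟶ AdicSeparated` while keeping the left half `KernelIdempotent` LOSES exactness —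
`𝔓 = ℚ[x^{ℚ≥0}] ⊨ KernelIdempotent ∧ AdicSeparated ∧ Cancellation ∧ ¬KrullSeparated ∧ ¬AdicDefect ∧ ¬S`;
the left half must rise to `AdicDefect` (and `AdicDefect ⟹ KernelIdempotent`, `Krull ⟹ AdicSeparated` on every
interface ring: `kernelIdempotent_of_adicDefect`, `adicSeparated_of_krull`). -/
theorem exchange_forced :
    KernelIdempotentI vPuis ∧ AdicSeparatedI vPuis ∧ CancellationI vPuis ∧
    ¬ KrullSeparatedI vPuis ∧ ¬ AdicDefectI vPuis ∧ ¬ SI vPuis :=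
  ⟨modelPuis_kernelIdempotent, modelPuis_adicSeparated, modelPuis_cancellation, modelPuis_not_krull,
    modelPuis_not_adicDefect, modelPuis_not_s⟩

/-- **STRICTNESS OF THE LATTICE EDGES**: `AdicSeparated ⇏ Cancellation` and `LocTriv ⇏ AdicDefect` (`𝔛`),
`Connected ⇏ AdicSeparated` (`𝔜`), `AdicDefect ⇏ 0541` (`ℝ × ℝ`), `0541 ⇏ AdicDefect` (`𝔑`),
`AdicSeparated ⇏ 27509` (`𝔛`). -/
theorem lattice_edges_strict :
    (AdicSeparatedI vCross ∧ ¬ CancellationI vCross) ∧ (LocTrivI vCross ∧ ¬ AdicDefectI vCross) ∧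
    (ConnectedI vHinge ∧ ¬ AdicSeparatedI vHinge) ∧
    (AdicDefectI vPair ∧ ¬ PiPowerDefectI vPair (Real.pi, Real.pi)) ∧
    (PiPowerDefectI vNil piNil ∧ ¬ AdicDefectI vNil) ∧
    (AdicSeparatedI vCross ∧ ¬ PiConnectedI vCross piCross) :=
  ⟨⟨modelCross_adicSeparated, modelCross_not_cancellation⟩, ⟨modelCross_locTriv, modelCross_not_adicDefect⟩,
    ⟨modelHinge_connected, modelHinge_not_adicSeparated⟩, ⟨modelPair_adicDefect, modelPair_not_piPower⟩,
    ⟨modelNil_piPower, modelNil_not_adicDefect⟩, ⟨modelCross_adicSeparated, modelCross_not_piConnected⟩⟩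

/-- **THE MIXED WEAK PAIR IS NOT A CUT**: `LocTriv ∧ AdicSeparated ⇏ S` — in the free one-pair stage `𝔛` and in the
torsion phantom `𝔑` (there even with 0541, 27508, 27509).  The exact diagonals pair matching strengths:
`(LocTriv, Cancellation)`, `(AdicDefect, AdicSeparated)`. -/
theorem mixed_pair_not_exact :
    (LocTrivI vCross ∧ AdicSeparatedI vCross ∧ ¬ SI vCross) ∧
    (PiPowerDefectI vNil piNil ∧ PiFlatDefectI vNil piNil ∧ PiConnectedI vNil piNil ∧ LocTrivI vNil ∧
      AdicSeparatedI vNil ∧ ¬ AdicDefectI vNil ∧ ¬ SI vNil) :=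
  ⟨⟨modelCross_locTriv, modelCross_adicSeparated, modelCross_not_s⟩,
    ⟨modelNil_piPower, modelNil_piFlat, modelNil_piConnected, modelNil_locTriv, modelNil_adicSeparated,
      modelNil_not_adicDefect, modelNil_not_s⟩⟩

/-- Γ-VERDICT MODEL (free one-pair stage): in `𝔛` the pair's defect `ϖ − g = 2d` is a `LocTriv`-instance (killed by
`s = (X, 0)` of value `π`) and a 27508-instance (`ϖ·d = d²`), but NOT an `AdicDefect`-instance — on the stage generated
by one undecided equal-value quadratic pair, `AdicDefect` at the pair's defect is exactly as hard as the pair identity. -/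
theorem modelCross_pair_defect :
    piCross - gCross = dCross + dCross ∧ (sCross * dCross = 0 ∧ vCross sCross = Real.pi) ∧
    piCross * dCross = dCross * dCross ∧ ¬ ∃ i : crossCarrier, vCross i = 0 ∧ i * dCross = dCross :=
  ⟨by
    apply Subtype.ext
    change ((X : ℚ[X]), (X : ℚ[X])) - (X, -X) = ((0 : ℚ[X]), (X : ℚ[X])) + (0, X)
    exact Prod.ext (by simp only [Prod.fst_sub, Prod.fst_add, sub_self, add_zero])
      (by simp only [Prod.snd_sub, Prod.snd_add, sub_neg_eq_add]),
    ⟨sCross_mul_dCross, vCross_sCross⟩, Subtype.ext (by simp), dCross_not_fixed⟩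

end Iface

end Summit.KontsevichZagierPeriods.RootDecompAdicStages

end
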